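import Mathlib
import Summits.KontsevichZagierPeriods.Zeta5Search.TypeSpaceLawZeroPointProof
import Summits.KontsevichZagierPeriods.Zeta5Search.DenomLaw.LawA5Depth8
import HarnessLib

/-!
# ζ(5) search — THEOREM ZL5: the ZERO-POINT law and THEOREM L5 in the same frame give a SIXTH digit, `v_p(Cas_j(b)) ≥ 9 − 2M` (DENOM-LAW D1, prover-d1 gen 21)

HONEST FRAMING: systematic search; no irrationality claim unless certified.  Cell `pub-zeta5`, track «DENOM-LAW» D1, seat `denom-prover-d1` gen 21
(`HOME/denom-law/prover-d1/ATTEMPT-21.md` §3).  `p`-adic valuations of the cell's OWN rationals (the contiguity Casoratian `Cas_j(b) = W(b+e_j)V(b) −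
W(b)V(b+e_j)` of Brown–Zudilin dual coefficients); nothing about ζ(5); no model exponent; records in print UNMOVED.

WHY.  After gen 20's census corrections and this seat's ports of the landed V-floor (`ZeroPointVFloor`, `ZeroPointVFloorPal`) the instances of the
∀-`b` node `DenomLaw.PathAccountingFirstPeriod` left open by every landed law form ONE family: a deep PALINDROMIC DOUBLE POLE `[(1,)−n,−n(,1)]` at the
frame exponent `−M` (`M = 10, 12`; e.g. `b = (12; 0⁷)`, `p = 7`: six classes `[−6,−6]` at `−12`), where THEOREM L5 (`lawA5_holds`, `8 − 2M`) and THEOREM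
ZA (`lawZeroPointA4`, `8 − 2M`) both fire and the node asks for exactly one digit more, `9 − 2M` (the «L6 corners» of ATTEMPT-18/20).
THE MECHANISM (= gen 20's ZA one order up, three lines over two landed aggregates): the ZERO-POINT law's `aggregate₃` with all live doubled orbit points
congruent and the residue congruence makes the normalised coefficients `w = W/(−p)^{3−M}`, `v = V/(−p)^{−M}` themselves `O(p²)` for `b` AND `b + e_j`
(`zeroPoint_wvNorm_of_residues`, the W-half now exported next to gen 20's V-half); THEOREM L5's `aggregate₅` gives the fourth-order collinearity
`2(w, v) ≡ A·t₁ (mod p⁴)` with ONE direction `t₁ = (frameTW 1, frameTV 1)` for `b` and `b + e_j`; hence `A·t₁ = 2w + O(p⁴) = O(p²)` and gen 10's `det₆`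
(`LawA5Shifted`) gives `w'v − wv' = O(p⁶)`, i.e. **`v_p(Cas_j(b)) ≥ 9 − 2M = casLB + 6`** (`zeroPointA5_of_residues`, `lawZeroPointA5`).  THEOREM L5⁺
(`lawA5_shifted`) obtained the same `O(p²)` from two EMPTY deep layers; here the deep layers are full and the smallness comes from the one-point type space.
Hypotheses = those of `ResidueLaw.TypeSpaceLawZeroPoint` (degree condition `p(M−2) + ΣE ≤ −4`, which implies L5's `p(M−4) ≤ 2d+1`) ∧ those of
`SecondResidueLaw.LawA5` in the same frame `(M, T)` ∧ «some multipole class of `b` has exponent `≤ −M + 2`» (true in the whole family: the double pole sits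
AT `−M`; it selects case (A) of the L5 proof, where the frame type has `E(T) = −M`).
Frames: `M ≥ 10` (`lawZeroPointA5`, over `lawA5_holds`' inputs) and `M ≥ 8` with every single-pole class of exponent `≥ −M + 4` (`lawZeroPointA5_depth8`,
over gen 10's `aggregate₅_d8` / `liveKappaSum_small_d8`); `T` is any palindrome satisfying the clauses, so the SHIFTED frames (deep layer `−M` empty, the
multipoles a conjugate pair of single raises of `T` at `−M + 1`, e.g. `[−5,−6]`/`[−6,−5]` of `T = [−6,−6]`) are covered as well.
USE (this seat's desk census on gen 18's exact tables, rung «ZL5» = these hypotheses ported at `M ∈ {−m, 1−m}`, 0 port violations): closes 18 / 102 / 35 / 32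
further instances at `p = 5 / 7 / 11 / 13` (the last two on gen 18's 30,000-samples), taking the share of first-period instances reached by LANDED laws to
**100 % (p = 5: all 6,387 rows) / 99.97 % (p = 7: 48,312 of 48,326) / 99.97 % / 99.98 %** (from 99.72 / 99.76 / 99.85 / 99.87 % after «ZVP»).
-/

noncomputable section

open Finset PowerSeries

namespace Summit.KontsevichZagierPeriods.Zeta5Search.SecondOrder

open Summit.KontsevichZagierPeriods.Zeta5Search.DualSeries (InBox)
open Summit.KontsevichZagierPeriods.Zeta5Search.WedgeDictionary (coeffW coeffV dOf)
open Summit.KontsevichZagierPeriods.Zeta5Search.CasoratianValuation (InPolytope shift casoratian)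
open Summit.KontsevichZagierPeriods.Zeta5Search.ClusterValuation
open Summit.KontsevichZagierPeriods.Zeta5Search.PadicSeries
open Summit.KontsevichZagierPeriods.Zeta5Search.LevelClass (typeExp)
open Summit.KontsevichZagierPeriods.Zeta5Search.BigPrime (shift_zero dOf_shift)
open Summit.KontsevichZagierPeriods.Zeta5Search.ResidueLaw (pointW pointV liveClasses res0_padicNorm_le sum_classExp_range)
open Summit.KontsevichZagierPeriods.Zeta5Search.RecordWindowsA4 (LawA4Classes)
open Summit.KontsevichZagierPeriods.Zeta5Search.SecondResidueLaw (ShapeClause)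

variable {p : ℕ} [hp : Fact p.Prime]

/-! ## §1 The zero-point law's `O(p²)` for BOTH coordinates, exported -/

/-- **Both halves of the zero-point law — conditional form**: under the class hypotheses of `TypeSpaceLawZeroPoint`, the residue congruences for `b`
and `b + e_j` and all live doubled orbit points congruent mod `p`, the normalised coefficients are `O(p²)`:
`‖W(b)/(−p)^{3−M}‖, ‖V(b)/(−p)^{−M}‖, ‖W(b+e_j)/(−p)^{3−M}‖, ‖V(b+e_j)/(−p)^{−M}‖ ≤ p⁻²`.  (The tree's `typeSpaceLawZeroPoint_of_residues`, its proof
copied up to these four bounds; gen 20's `zeroPoint_vNorm_of_residues` is the V-half.) -/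
theorem zeroPoint_wvNorm_of_residues (b : ℕ → ℤ) (p j M : ℕ) (hb : InPolytope b) (hb' : InPolytope (shift b j))
    (hj1 : 1 ≤ j) (hj7 : j ≤ 7) (hprime : p.Prime) (hp5 : 5 ≤ p) (hpb : (p : ℤ) ≤ b 0) (hwin : (b 0 + 2 : ℤ) < (p : ℤ) ^ 2)
    (hM : 6 ≤ M) (hMe : Even M)
    (G1 : ∀ x, x < p → 1 ≤ classPoleCount b p x → -(M : ℤ) ≤ classExp b p x)
    (G3 : ∀ x, x < p → 1 ≤ classPoleCount b p x → classExp b p x = -(M : ℤ) →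
      ¬ CentreIn b p x ∧ (classTypeList b p x).reverse = classTypeList b p x)
    (HP : ∀ x ∈ liveClasses b p M, ∀ y ∈ liveClasses b p M,
        (pointW b p M y - pointW b p M x = 0 ∨ 1 ≤ padicValRat p (pointW b p M y - pointW b p M x)) ∧
        (pointV b p M y - pointV b p M x = 0 ∨ 1 ≤ padicValRat p (pointV b p M y - pointV b p M x)))
    (hres : padicNorm p
      ((∑ z ∈ (range p).filter (fun x => 1 ≤ classPoleCount b p x ∧ classExp b p x = -(M : ℤ)), gHat b p z * phiHat b p z)
        + ∑ z ∈ (range p).filter (fun x => 1 ≤ classPoleCount b p x ∧ classExp b p x = -(M : ℤ) + 1), gHat b p z)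
      ≤ (p : ℚ) ^ (-(1 : ℤ)))
    (hres' : padicNorm p
      ((∑ z ∈ (range p).filter (fun x => 1 ≤ classPoleCount (shift b j) p x ∧ classExp (shift b j) p x = -(M : ℤ)),
          gHat (shift b j) p z * phiHat (shift b j) p z)
        + ∑ z ∈ (range p).filter (fun x => 1 ≤ classPoleCount (shift b j) p x ∧ classExp (shift b j) p x = -(M : ℤ) + 1),
          gHat (shift b j) p z)
      ≤ (p : ℚ) ^ (-(1 : ℤ))) :
    padicNorm p (coeffW b / (-(p : ℚ)) ^ (-(M : ℤ) + 3)) ≤ (p : ℚ) ^ (-(2 : ℤ)) ∧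
      padicNorm p (coeffV b / (-(p : ℚ)) ^ (-(M : ℤ))) ≤ (p : ℚ) ^ (-(2 : ℤ)) ∧
      padicNorm p (coeffW (shift b j) / (-(p : ℚ)) ^ (-(M : ℤ) + 3)) ≤ (p : ℚ) ^ (-(2 : ℤ)) ∧
      padicNorm p (coeffV (shift b j) / (-(p : ℚ)) ^ (-(M : ℤ))) ≤ (p : ℚ) ^ (-(2 : ℤ)) := by
  haveI : Fact p.Prime := ⟨hprime⟩
  have hp0 : (p : ℚ) ≠ 0 := Nat.cast_ne_zero.2 hprime.ne_zero
  have hp2 : p ≠ 2 := by omega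
  have h0 : 0 ≤ b 0 := hb.1.1
  obtain ⟨-, -, -, hn⟩ := thmA_data b hb hwin
  have h4n : padicNorm p (4 : ℚ) = 1 := by
    rw [show (4 : ℚ) = 2 * 2 by norm_num, padicNorm.mul, padicNorm_two hp2, one_mul]
  -- the aggregates for `b` and `b + e_j`
  obtain ⟨X, Y, k, -, -, hW, hV, hk1, hkL, hksum, hXa, hYa⟩ := aggregate₃ b hb hp5 hpb hwin hM hMe G1 G3
  have hpb' : (p : ℤ) ≤ shift b j 0 := by rw [shift_zero b hj1]; exact hpb
  have hwin' : (shift b j 0 + 2 : ℤ) < (p : ℤ) ^ 2 := by rw [shift_zero b hj1]; exact hwin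
  obtain ⟨X', Y', k', -, -, hW', hV', hk1', hkL', hksum', hXa', hYa'⟩ := aggregate₃ (shift b j) hb' hp5 hpb' hwin' hM hMe
    (G1_shift b hb hj1 G1) (G3_shift b hb hb' hj1 hj7 hpb G1 G3)
  have hPt : ∀ z, k' z ≠ 0 → z ∈ liveClasses b p M ∧ pointW (shift b j) p M z = pointW b p M z ∧
      pointV (shift b j) p M z = pointV b p M z := fun z hz =>
    point_transfer b hb hb' hj1 hj7 hpb hM hMe G1 G3 (hkL' z hz)
  -- a base point
  obtain ⟨x₀, hx₀⟩ : ∃ x₀, ∀ z ∈ liveClasses b p M, x₀ ∈ liveClasses b p M := by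
    by_cases h : (liveClasses b p M).Nonempty
    · obtain ⟨x, hx⟩ := h; exact ⟨x, fun _ _ => hx⟩
    · exact ⟨0, fun z hz => absurd ⟨z, hz⟩ h⟩
  have hP0 := padicNorm_point_le_one b h0 hn hp2 M x₀
  -- the weight sums are `O(p)`
  have hsum : padicNorm p (∑ z ∈ range p, k z) ≤ (p : ℚ) ^ (-(1 : ℤ)) := by
    have e : ∑ z ∈ range p, k z = (4 * ∑ z ∈ range p, k z) / 4 := by ring
    rw [e, padicNorm.div, h4n, div_one, hksum]; exact hres
  have hsum' : padicNorm p (∑ z ∈ range p, k' z) ≤ (p : ℚ) ^ (-(1 : ℤ)) := by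
    have e : ∑ z ∈ range p, k' z = (4 * ∑ z ∈ range p, k' z) / 4 := by ring
    rw [e, padicNorm.div, h4n, div_one, hksum']; exact hres'
  -- all points equal mod `p` ⇒ the aggregates vanish mod `p`
  have hXp : padicNorm p X ≤ (p : ℚ) ^ (-(1 : ℤ)) :=
    norm_le_of_equal_points hXa hsum hk1 hP0.1 fun z hz =>
      padicNorm_le_of_zero_or_val (HP x₀ (hx₀ z (hkL z hz)) z (hkL z hz)).1
  have hYp : padicNorm p Y ≤ (p : ℚ) ^ (-(1 : ℤ)) :=
    norm_le_of_equal_points hYa hsum hk1 hP0.2 fun z hz =>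
      padicNorm_le_of_zero_or_val (HP x₀ (hx₀ z (hkL z hz)) z (hkL z hz)).2
  have hXp' : padicNorm p X' ≤ (p : ℚ) ^ (-(1 : ℤ)) :=
    norm_le_of_equal_points hXa' hsum' hk1' hP0.1 fun z hz => by
      obtain ⟨hzL, hPW, -⟩ := hPt z hz
      rw [hPW]
      exact padicNorm_le_of_zero_or_val (HP x₀ (hx₀ z hzL) z hzL).1
  have hYp' : padicNorm p Y' ≤ (p : ℚ) ^ (-(1 : ℤ)) :=
    norm_le_of_equal_points hYa' hsum' hk1' hP0.2 fun z hz => by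
      obtain ⟨hzL, -, hPV⟩ := hPt z hz
      rw [hPV]
      exact padicNorm_le_of_zero_or_val (HP x₀ (hx₀ z hzL) z hzL).2
  exact ⟨norm_le_two_of_X hW hXp, norm_le_two_of_X hV hYp, norm_le_two_of_X hW' hXp', norm_le_two_of_X hV' hYp'⟩

/-! ## §2 THEOREM ZL5 -/

/-- **`A·t` is `O(p²)` when `w` is (fourth-order version)**: `‖2w − At‖ ≤ p⁻⁴` and `‖w‖ ≤ p⁻²` give `‖At‖ ≤ p⁻²`. -/
theorem norm_At_le₄ (hp2 : p ≠ 2) {w At : ℚ} (h : padicNorm p (2 * w - At) ≤ (p : ℚ) ^ (-(4 : ℤ)))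
    (hw : padicNorm p w ≤ (p : ℚ) ^ (-(2 : ℤ))) : padicNorm p At ≤ (p : ℚ) ^ (-(2 : ℤ)) := by
  have e : At = 2 * w - (2 * w - At) := by ring
  rw [e]
  refine fo_sub ?_ (fo_weak h (by norm_num))
  rw [padicNorm.mul, padicNorm_two hp2, one_mul]; exact hw

/-- **An `O(p⁶)` minor gives `9 − 2M`**: `Cas_j(b) = (−p)^{3−2M}·(w'v − wv')`, so `‖w'v − wv'‖ ≤ p⁻⁶` gives `v_p(Cas_j(b)) ≥ 9 − 2M`. -/
theorem cas_ge_nine_of_det₆ (b : ℕ → ℤ) (j M : ℕ)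
    (hdet : padicNorm p (coeffW (shift b j) / (-(p : ℚ)) ^ (-(M : ℤ) + 3) * (coeffV b / (-(p : ℚ)) ^ (-(M : ℤ)))
      - coeffW b / (-(p : ℚ)) ^ (-(M : ℤ) + 3) * (coeffV (shift b j) / (-(p : ℚ)) ^ (-(M : ℤ)))) ≤ (p : ℚ) ^ (-(6 : ℤ)))
    (hcas : casoratian b j ≠ 0) : (9 : ℤ) - 2 * M ≤ padicValRat p (casoratian b j) := by
  have hp0 : (p : ℚ) ≠ 0 := Nat.cast_ne_zero.2 hp.out.ne_zero
  have hpneg : (-(p : ℚ)) ≠ 0 := neg_ne_zero.2 hp0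
  set w := coeffW b / (-(p : ℚ)) ^ (-(M : ℤ) + 3)
  set v := coeffV b / (-(p : ℚ)) ^ (-(M : ℤ))
  set w' := coeffW (shift b j) / (-(p : ℚ)) ^ (-(M : ℤ) + 3)
  set v' := coeffV (shift b j) / (-(p : ℚ)) ^ (-(M : ℤ))
  have hcasE : casoratian b j = (-(p : ℚ)) ^ (-(M : ℤ) + 3) * (-(p : ℚ)) ^ (-(M : ℤ)) * (w' * v - w * v') := by
    have e1 : coeffW b = w * (-(p : ℚ)) ^ (-(M : ℤ) + 3) := by
      simp only [w]; rw [div_mul_cancel₀ _ (zpow_ne_zero _ hpneg)]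
    have e2 : coeffV b = v * (-(p : ℚ)) ^ (-(M : ℤ)) := by
      simp only [v]; rw [div_mul_cancel₀ _ (zpow_ne_zero _ hpneg)]
    have e3 : coeffW (shift b j) = w' * (-(p : ℚ)) ^ (-(M : ℤ) + 3) := by
      simp only [w']; rw [div_mul_cancel₀ _ (zpow_ne_zero _ hpneg)]
    have e4 : coeffV (shift b j) = v' * (-(p : ℚ)) ^ (-(M : ℤ)) := by
      simp only [v']; rw [div_mul_cancel₀ _ (zpow_ne_zero _ hpneg)]
    unfold casoratian
    rw [e1, e2, e3, e4]; ring
  apply val_ge_of_padicNorm_le hcas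
  rw [hcasE, padicNorm.mul, padicNorm.mul, LevelClass.padicNorm_neg_p_zpow, LevelClass.padicNorm_neg_p_zpow]
  calc (p : ℚ) ^ (-(-(M : ℤ) + 3)) * (p : ℚ) ^ (-(-(M : ℤ))) * padicNorm p (w' * v - w * v')
      ≤ (p : ℚ) ^ (-(-(M : ℤ) + 3)) * (p : ℚ) ^ (-(-(M : ℤ))) * (p : ℚ) ^ (-(6 : ℤ)) :=
        mul_le_mul_of_nonneg_left hdet (mul_nonneg (zpow_p_nonneg _) (zpow_p_nonneg _))
    _ = (p : ℚ) ^ (-((9 : ℤ) - 2 * M)) := by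
        rw [← zpow_add₀ hp0, ← zpow_add₀ hp0]; congr 1; ring

/-- **THEOREM ZL5 — conditional form**: the class hypotheses of `TypeSpaceLawZeroPoint` with the residue congruences for `b` and `b + e_j` and all live
doubled orbit points congruent mod `p`, together with the hypotheses of THEOREM L5 (`SecondResidueLaw.LawA5`: `M ≥ 10` even, frame `(M, T)` with `T` a
palindrome, `LawA4Classes` and `ShapeClause` for `b` and `b + e_j`, `p(M−4) ≤ 2d(b) + 1`) and one multipole class of `b` of exponent `≤ −M + 2`, give
`v_p(Cas_j(b)) ≥ 9 − 2M`. -/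
theorem zeroPointA5_of_residues (b : ℕ → ℤ) (p j M : ℕ) (T : List ℤ) (hb : InPolytope b) (hb' : InPolytope (shift b j))
    (hj1 : 1 ≤ j) (hj7 : j ≤ 7) (hprime : p.Prime) (hp5 : 5 ≤ p) (hpb : (p : ℤ) ≤ b 0) (hwin : (b 0 + 2 : ℤ) < (p : ℤ) ^ 2)
    (hM : 10 ≤ M) (hMe : Even M)
    (G1 : ∀ x, x < p → 1 ≤ classPoleCount b p x → -(M : ℤ) ≤ classExp b p x)
    (G3 : ∀ x, x < p → 1 ≤ classPoleCount b p x → classExp b p x = -(M : ℤ) →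
      ¬ CentreIn b p x ∧ (classTypeList b p x).reverse = classTypeList b p x)
    (HP : ∀ x ∈ liveClasses b p M, ∀ y ∈ liveClasses b p M,
        (pointW b p M y - pointW b p M x = 0 ∨ 1 ≤ padicValRat p (pointW b p M y - pointW b p M x)) ∧
        (pointV b p M y - pointV b p M x = 0 ∨ 1 ≤ padicValRat p (pointV b p M y - pointV b p M x)))
    (hres : padicNorm p
      ((∑ z ∈ (range p).filter (fun x => 1 ≤ classPoleCount b p x ∧ classExp b p x = -(M : ℤ)), gHat b p z * phiHat b p z)
        + ∑ z ∈ (range p).filter (fun x => 1 ≤ classPoleCount b p x ∧ classExp b p x = -(M : ℤ) + 1), gHat b p z)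
      ≤ (p : ℚ) ^ (-(1 : ℤ)))
    (hres' : padicNorm p
      ((∑ z ∈ (range p).filter (fun x => 1 ≤ classPoleCount (shift b j) p x ∧ classExp (shift b j) p x = -(M : ℤ)),
          gHat (shift b j) p z * phiHat (shift b j) p z)
        + ∑ z ∈ (range p).filter (fun x => 1 ≤ classPoleCount (shift b j) p x ∧ classExp (shift b j) p x = -(M : ℤ) + 1),
          gHat (shift b j) p z)
      ≤ (p : ℚ) ^ (-(1 : ℤ)))
    (hT : T.reverse = T) (hC : LawA4Classes b p M T) (hC' : LawA4Classes (shift b j) p M T)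
    (hS : ShapeClause b p M T) (hS' : ShapeClause (shift b j) p M T)
    (hdeg5 : (p : ℤ) * ((M : ℤ) - 4) ≤ 2 * dOf b + 1)
    (hlow : ∃ x, x < p ∧ 2 ≤ classPoleCount b p x ∧ classExp b p x ≤ -(M : ℤ) + 2)
    (hcas : casoratian b j ≠ 0) : (9 : ℤ) - 2 * M ≤ padicValRat p (casoratian b j) := by
  haveI : Fact p.Prime := ⟨hprime⟩
  have hp2 : p ≠ 2 := by omega
  have hpb' : (p : ℤ) ≤ shift b j 0 := by rw [shift_zero b hj1]; exact hpb
  have hwin' : (shift b j 0 + 2 : ℤ) < (p : ℤ) ^ 2 := by rw [shift_zero b hj1]; exact hwin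
  -- ### the zero-point law: `w, v, w', v'` are `O(p²)`
  obtain ⟨hw, hv, hw', hv'⟩ := zeroPoint_wvNorm_of_residues b p j M hb hb' hj1 hj7 hprime hp5 hpb hwin (by omega) hMe G1 G3 HP
    hres hres'
  -- ### THEOREM L5's aggregates: `2(w, v) ≡ A·t₁ (mod p⁴)` for `b` and `b + e_j` (case (A) of `lawA5_of_residueLaw`)
  obtain ⟨x, hx, h2, hE⟩ := hlow
  have hTM : typeExp (tTop T) (tList T) = -(M : ℤ) :=
    (typeExp_frame_or_top b hb hp5 hpb hMe hT hC hx h2 (by omega)).resolve_right (by omega)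
  have hresL := liveKappaSum_small b hb hp5 hpb hwin hM hMe hC.1 (by omega)
  have hresL' := liveKappaSum_small (shift b j) hb' hp5 hpb' hwin' hM hMe hC'.1 (by rw [dOf_shift b hj1 hj7]; omega)
  obtain ⟨A, -, hW, hV⟩ :=
    aggregate₅ b hb hp5 hpb hwin hM hMe hT hC hS fourthDigitW_holds fourthDigitV_holds hTM hresL
  obtain ⟨A', -, hW', hV'⟩ :=
    aggregate₅ (shift b j) hb' hp5 hpb' hwin' hM hMe hT hC' hS' fourthDigitW_holds fourthDigitV_holds hTM hresL'
  -- ### hence `A·t₁ = O(p²)` and the determinant is `O(p⁶)`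
  have hdet : padicNorm p (coeffW (shift b j) / (-(p : ℚ)) ^ (-(M : ℤ) + 3) * (coeffV b / (-(p : ℚ)) ^ (-(M : ℤ)))
      - coeffW b / (-(p : ℚ)) ^ (-(M : ℤ) + 3) * (coeffV (shift b j) / (-(p : ℚ)) ^ (-(M : ℤ)))) ≤ (p : ℚ) ^ (-(6 : ℤ)) :=
    det₆ hp2 hW hV hW' hV' (norm_At_le₄ hp2 hW hw) (norm_At_le₄ hp2 hV hv) (norm_At_le₄ hp2 hW' hw') (norm_At_le₄ hp2 hV' hv')
  exact cas_ge_nine_of_det₆ b j M hdet hcas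

/-- **THEOREM ZL5**: `ResidueLaw.TypeSpaceLawZeroPoint`'s hypotheses (degree condition `p(M−2) + ΣE_x ≤ −4`, all live doubled orbit points congruent
mod `p`) AND THEOREM L5's class clauses in the same frame `(M, T)` (`M ≥ 10` even, `T` a palindrome, `LawA4Classes` and `ShapeClause` for `b` and
`b + e_j`), with some multipole class of `b` of exponent `≤ −M + 2`, give `v_p(Cas_j(b)) ≥ 9 − 2M`.  (L5's degree condition `p(M−4) ≤ 2d+1` follows
from the zero-point one, since `ΣE_x = −2d − 5`.) -/
theorem lawZeroPointA5 (b : ℕ → ℤ) (p j M : ℕ) (T : List ℤ) (hb : InPolytope b) (hb' : InPolytope (shift b j))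
    (hj1 : 1 ≤ j) (hj7 : j ≤ 7) (hprime : p.Prime) (hp5 : 5 ≤ p) (hpb : (p : ℤ) ≤ b 0) (hwin : (b 0 + 2 : ℤ) < (p : ℤ) ^ 2)
    (hM : 10 ≤ M) (hMe : Even M)
    (G1 : ∀ x, x < p → 1 ≤ classPoleCount b p x → -(M : ℤ) ≤ classExp b p x)
    (G3 : ∀ x, x < p → 1 ≤ classPoleCount b p x → classExp b p x = -(M : ℤ) →
      ¬ CentreIn b p x ∧ (classTypeList b p x).reverse = classTypeList b p x)
    (hdeg : (p : ℤ) * ((M : ℤ) - 2) + ∑ x ∈ range p, classExp b p x ≤ -4)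
    (HP : ∀ x ∈ liveClasses b p M, ∀ y ∈ liveClasses b p M,
        (pointW b p M y - pointW b p M x = 0 ∨ 1 ≤ padicValRat p (pointW b p M y - pointW b p M x)) ∧
        (pointV b p M y - pointV b p M x = 0 ∨ 1 ≤ padicValRat p (pointV b p M y - pointV b p M x)))
    (hT : T.reverse = T) (hC : LawA4Classes b p M T) (hC' : LawA4Classes (shift b j) p M T)
    (hS : ShapeClause b p M T) (hS' : ShapeClause (shift b j) p M T)
    (hlow : ∃ x, x < p ∧ 2 ≤ classPoleCount b p x ∧ classExp b p x ≤ -(M : ℤ) + 2)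
    (hcas : casoratian b j ≠ 0) : (9 : ℤ) - 2 * M ≤ padicValRat p (casoratian b j) := by
  haveI : Fact p.Prime := ⟨hprime⟩
  have hdegb : (p : ℤ) * ((M : ℤ) - 2) + ∑ x ∈ range p, classExp b p x ≤ -2 := by omega
  have hsumE := sum_classExp_range b hb hp5
  have hsum : ∑ x ∈ range p, classExp (shift b j) p x = ∑ x ∈ range p, classExp b p x + 2 := by
    rw [sum_classExp_range (shift b j) hb' hp5, hsumE, dOf_shift b hj1 hj7]
    ring
  have hdeg' : (p : ℤ) * ((M : ℤ) - 2) + ∑ x ∈ range p, classExp (shift b j) p x ≤ -2 := by omega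
  have hpb' : (p : ℤ) ≤ shift b j 0 := by rw [shift_zero b hj1]; exact hpb
  have hp0 : (0 : ℤ) ≤ p := by positivity
  have hdeg5 : (p : ℤ) * ((M : ℤ) - 4) ≤ 2 * dOf b + 1 := by
    rw [hsumE] at hdeg; nlinarith
  exact zeroPointA5_of_residues b p j M T hb hb' hj1 hj7 hprime hp5 hpb hwin hM hMe G1 G3 HP
    (res0_padicNorm_le b M hb hp5 hpb (by omega) G1 hdegb)
    (res0_padicNorm_le (shift b j) M hb' hp5 hpb' (by omega) (G1_shift b hb hj1 G1) hdeg') hT hC hC' hS hS' hdeg5 hlow hcas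

/-! ## §3 THEOREM ZL5 at frame depth `M ≥ 8` (with gen 10's L5₈: every single-pole class of exponent `≥ −M + 4`) -/

/-- **THEOREM ZL5₈ — conditional form**: as `zeroPointA5_of_residues` with `8 ≤ M` in place of `10 ≤ M`, PLUS (as in `lawA5_depth8`) every single-pole
class of `b` and of `b + e_j` of exponent `≥ −M + 4`.  Then `v_p(Cas_j(b)) ≥ 9 − 2M`. -/
theorem zeroPointA5_depth8_of_residues (b : ℕ → ℤ) (p j M : ℕ) (T : List ℤ) (hb : InPolytope b) (hb' : InPolytope (shift b j))
    (hj1 : 1 ≤ j) (hj7 : j ≤ 7) (hprime : p.Prime) (hp5 : 5 ≤ p) (hpb : (p : ℤ) ≤ b 0) (hwin : (b 0 + 2 : ℤ) < (p : ℤ) ^ 2)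
    (hM : 8 ≤ M) (hMe : Even M)
    (G1 : ∀ x, x < p → 1 ≤ classPoleCount b p x → -(M : ℤ) ≤ classExp b p x)
    (G3 : ∀ x, x < p → 1 ≤ classPoleCount b p x → classExp b p x = -(M : ℤ) →
      ¬ CentreIn b p x ∧ (classTypeList b p x).reverse = classTypeList b p x)
    (HP : ∀ x ∈ liveClasses b p M, ∀ y ∈ liveClasses b p M,
        (pointW b p M y - pointW b p M x = 0 ∨ 1 ≤ padicValRat p (pointW b p M y - pointW b p M x)) ∧
        (pointV b p M y - pointV b p M x = 0 ∨ 1 ≤ padicValRat p (pointV b p M y - pointV b p M x)))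
    (hres : padicNorm p
      ((∑ z ∈ (range p).filter (fun x => 1 ≤ classPoleCount b p x ∧ classExp b p x = -(M : ℤ)), gHat b p z * phiHat b p z)
        + ∑ z ∈ (range p).filter (fun x => 1 ≤ classPoleCount b p x ∧ classExp b p x = -(M : ℤ) + 1), gHat b p z)
      ≤ (p : ℚ) ^ (-(1 : ℤ)))
    (hres' : padicNorm p
      ((∑ z ∈ (range p).filter (fun x => 1 ≤ classPoleCount (shift b j) p x ∧ classExp (shift b j) p x = -(M : ℤ)),
          gHat (shift b j) p z * phiHat (shift b j) p z)
        + ∑ z ∈ (range p).filter (fun x => 1 ≤ classPoleCount (shift b j) p x ∧ classExp (shift b j) p x = -(M : ℤ) + 1),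
          gHat (shift b j) p z)
      ≤ (p : ℚ) ^ (-(1 : ℤ)))
    (hT : T.reverse = T) (hC : LawA4Classes b p M T) (hC' : LawA4Classes (shift b j) p M T)
    (hS : ShapeClause b p M T) (hS' : ShapeClause (shift b j) p M T)
    (hdeg5 : (p : ℤ) * ((M : ℤ) - 4) ≤ 2 * dOf b + 1)
    (hsing : ∀ y, y < p → classPoleCount b p y = 1 → -(M : ℤ) + 4 ≤ classExp b p y)
    (hsing' : ∀ y, y < p → classPoleCount (shift b j) p y = 1 → -(M : ℤ) + 4 ≤ classExp (shift b j) p y)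
    (hlow : ∃ x, x < p ∧ 2 ≤ classPoleCount b p x ∧ classExp b p x ≤ -(M : ℤ) + 2)
    (hcas : casoratian b j ≠ 0) : (9 : ℤ) - 2 * M ≤ padicValRat p (casoratian b j) := by
  haveI : Fact p.Prime := ⟨hprime⟩
  have hp2 : p ≠ 2 := by omega
  have hpb' : (p : ℤ) ≤ shift b j 0 := by rw [shift_zero b hj1]; exact hpb
  have hwin' : (shift b j 0 + 2 : ℤ) < (p : ℤ) ^ 2 := by rw [shift_zero b hj1]; exact hwin
  obtain ⟨hw, hv, hw', hv'⟩ := zeroPoint_wvNorm_of_residues b p j M hb hb' hj1 hj7 hprime hp5 hpb hwin (by omega) hMe G1 G3 HP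
    hres hres'
  obtain ⟨x, hx, h2, hE⟩ := hlow
  have hTM : typeExp (tTop T) (tList T) = -(M : ℤ) :=
    (typeExp_frame_or_top b hb hp5 hpb hMe hT hC hx h2 (by omega)).resolve_right (by omega)
  have hresL := liveKappaSum_small_d8 b hb hp5 hpb hwin hM hMe hC.1 hsing (by omega)
  have hresL' := liveKappaSum_small_d8 (shift b j) hb' hp5 hpb' hwin' hM hMe hC'.1 hsing' (by rw [dOf_shift b hj1 hj7]; omega)
  obtain ⟨A, -, hW, hV⟩ :=
    aggregate₅_d8 b hb hp5 hpb hwin hM hMe hT hC hS fourthDigitW_holds fourthDigitV_holds hsing hTM hresL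
  obtain ⟨A', -, hW', hV'⟩ :=
    aggregate₅_d8 (shift b j) hb' hp5 hpb' hwin' hM hMe hT hC' hS' fourthDigitW_holds fourthDigitV_holds hsing' hTM hresL'
  exact cas_ge_nine_of_det₆ b j M
    (det₆ hp2 hW hV hW' hV' (norm_At_le₄ hp2 hW hw) (norm_At_le₄ hp2 hV hv) (norm_At_le₄ hp2 hW' hw') (norm_At_le₄ hp2 hV' hv'))
    hcas

/-- **THEOREM ZL5₈**: `lawZeroPointA5` at frame depth `M ≥ 8`, with every single-pole class of `b` and `b + e_j` of exponent `≥ −M + 4`. -/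
theorem lawZeroPointA5_depth8 (b : ℕ → ℤ) (p j M : ℕ) (T : List ℤ) (hb : InPolytope b) (hb' : InPolytope (shift b j))
    (hj1 : 1 ≤ j) (hj7 : j ≤ 7) (hprime : p.Prime) (hp5 : 5 ≤ p) (hpb : (p : ℤ) ≤ b 0) (hwin : (b 0 + 2 : ℤ) < (p : ℤ) ^ 2)
    (hM : 8 ≤ M) (hMe : Even M)
    (G1 : ∀ x, x < p → 1 ≤ classPoleCount b p x → -(M : ℤ) ≤ classExp b p x)
    (G3 : ∀ x, x < p → 1 ≤ classPoleCount b p x → classExp b p x = -(M : ℤ) →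
      ¬ CentreIn b p x ∧ (classTypeList b p x).reverse = classTypeList b p x)
    (hdeg : (p : ℤ) * ((M : ℤ) - 2) + ∑ x ∈ range p, classExp b p x ≤ -4)
    (HP : ∀ x ∈ liveClasses b p M, ∀ y ∈ liveClasses b p M,
        (pointW b p M y - pointW b p M x = 0 ∨ 1 ≤ padicValRat p (pointW b p M y - pointW b p M x)) ∧
        (pointV b p M y - pointV b p M x = 0 ∨ 1 ≤ padicValRat p (pointV b p M y - pointV b p M x)))
    (hT : T.reverse = T) (hC : LawA4Classes b p M T) (hC' : LawA4Classes (shift b j) p M T)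
    (hS : ShapeClause b p M T) (hS' : ShapeClause (shift b j) p M T)
    (hsing : ∀ y, y < p → classPoleCount b p y = 1 → -(M : ℤ) + 4 ≤ classExp b p y)
    (hsing' : ∀ y, y < p → classPoleCount (shift b j) p y = 1 → -(M : ℤ) + 4 ≤ classExp (shift b j) p y)
    (hlow : ∃ x, x < p ∧ 2 ≤ classPoleCount b p x ∧ classExp b p x ≤ -(M : ℤ) + 2)
    (hcas : casoratian b j ≠ 0) : (9 : ℤ) - 2 * M ≤ padicValRat p (casoratian b j) := by
  haveI : Fact p.Prime := ⟨hprime⟩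
  have hdegb : (p : ℤ) * ((M : ℤ) - 2) + ∑ x ∈ range p, classExp b p x ≤ -2 := by omega
  have hsumE := sum_classExp_range b hb hp5
  have hsum : ∑ x ∈ range p, classExp (shift b j) p x = ∑ x ∈ range p, classExp b p x + 2 := by
    rw [sum_classExp_range (shift b j) hb' hp5, hsumE, dOf_shift b hj1 hj7]
    ring
  have hdeg' : (p : ℤ) * ((M : ℤ) - 2) + ∑ x ∈ range p, classExp (shift b j) p x ≤ -2 := by omega
  have hpb' : (p : ℤ) ≤ shift b j 0 := by rw [shift_zero b hj1]; exact hpb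
  have hp0 : (0 : ℤ) ≤ p := by positivity
  have hdeg5 : (p : ℤ) * ((M : ℤ) - 4) ≤ 2 * dOf b + 1 := by
    rw [hsumE] at hdeg; nlinarith
  exact zeroPointA5_depth8_of_residues b p j M T hb hb' hj1 hj7 hprime hp5 hpb hwin hM hMe G1 G3 HP
    (res0_padicNorm_le b M hb hp5 hpb (by omega) G1 hdegb)
    (res0_padicNorm_le (shift b j) M hb' hp5 hpb' (by omega) (G1_shift b hb hj1 G1) hdeg') hT hC hC' hS hS' hdeg5 hsing hsing'
    hlow hcas

end Summit.KontsevichZagierPeriods.Zeta5Search.SecondOrder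

end
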